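import Mathlib
import HarnessLib
import Summits.PneNP.PneNP.Theorems.CnfIdealGenLengthRankStability
import Summits.PneNP.PneNP.Theorems.CnfIdealGenLengthRankDefectRepresentationsPhantomTransfer
import Literature.Barriers.ValiantsHypothesis.BIJL18MatrixCompletionProofs

/-!
# Crux `RankDefectRepresentations` (stmt-PneNP-18923): the BLOCK LAW (negative tool of the lead, line `phantom-kernel`)

An almost-representation of the Boolean cube that is a DIRECT SUM OF SMALL BLOCKS is close to a genuine
representation: if every `M_i` is block diagonal with blocks of size `m` (any number of blocks), and every
Boolean / commutator axiom has rank `≤ t` at `M`, then at most `(n² + n) · t` blocks fail to be commuting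
idempotent tuples (each failing block carries rank `≥ 1` of some axiom, and ranks ADD over blocks,
`Literature.Barriers.ValiantsHypothesis.rank_blockDiagonal`), so zeroing those blocks gives pairwise commuting
idempotents `M'` with `rank (M_i - M'_i) ≤ (n² + n) · t · m` (`exists_genuine_near_of_blockDiagonal`).
Consequences (with the landed `rank_eval_clauseProduct_le_size_mul`, p542939): for every unsatisfiable CNF `φ`,
`rank P_φ(M) ≤ size φ · (n² + n) · t · m` (`rank_clauseProduct_le_of_blockDiagonal`) — so NO direct sum of
gadgets of bounded (or polynomial) block size can witness `RankDefectRepresentations`, rung 2 of the rank-Dehn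
ladder, or the contradictory-phantom stub S1 of the line `phantom-kernel` (whose phantom kernel sits below
`rank P_φ` by peeling): the "gadget law" of the line card and dead classes (i)–(v) of
`Cruxes/RankDefectRepresentations/Lines/dead-RDR-analysis-v2.md`, kernel-checked in one statement.  A witness of
the crux must therefore carry its defects on INDECOMPOSABLE blocks of superpolynomial dimension.
HONEST FRAMING: elementary linear algebra; P ≠ NP is not moved; F-N2 is a FRONTIER formal rung.
-/

set_option linter.dupNamespace false -- `Summit.PneNP.PneNP.…`: summit = sub-problem name (D-0017)

namespace Summit.PneNP.PneNP.Theorems.CnfIdealGenLength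

open Filter
open Literature.Computability.Complexity
open Literature.Computability.MetaComplexity
open Literature.Computability.MetaComplexity.NCIPS

section BlockLaw

variable {K : Type} [Field K] {n m d : ℕ} {o : Type} [Fintype o] [DecidableEq o]

/-- Evaluation of a non-commutative polynomial at a block-diagonal tuple is block diagonal, with the blockwise
evaluations as blocks. [folklore] -/
theorem lift_blockDiagonal (B : Fin n → o → Matrix (Fin m) (Fin m) K)
    (g : MonoidAlgebra K (FreeMonoid (Fin n))) :
    MonoidAlgebra.lift K (Matrix (Fin m × o) (Fin m × o) K) (FreeMonoid (Fin n))
        (FreeMonoid.lift fun i => Matrix.blockDiagonal (B i)) g =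
      Matrix.blockDiagonal fun k =>
        MonoidAlgebra.lift K (Matrix (Fin m) (Fin m) K) (FreeMonoid (Fin n)) (FreeMonoid.lift fun i => B i k) g := by
  induction g using MonoidAlgebra.induction_on with
  | hM w =>
    rw [MonoidAlgebra.lift_of]
    simp only [MonoidAlgebra.lift_of]
    induction w using FreeMonoid.inductionOn' with
    | one =>
      simp only [map_one]
      exact (Matrix.blockDiagonal_one : Matrix.blockDiagonal (1 : o → Matrix (Fin m) (Fin m) K) = 1).symm
    | mul_of b w ih =>
      rw [map_mul, ih, FreeMonoid.lift_eval_of, ← Matrix.blockDiagonal_mul]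
      congr 1
      funext k
      rw [map_mul, FreeMonoid.lift_eval_of]
  | hadd x y hx hy =>
    rw [map_add, hx, hy, ← Matrix.blockDiagonal_add]
    congr 1; funext k; simp only [Pi.add_apply, map_add]
  | hsmul r x hx =>
    rw [map_smul, hx, ← Matrix.blockDiagonal_smul]
    congr 1; funext k; simp only [Pi.smul_apply, map_smul]

/-- Evaluation commutes with an algebra homomorphism of the target (e.g. reindexing the matrices). [folklore] -/
theorem lift_algHom {A B : Type} [Ring A] [Algebra K A] [Ring B] [Algebra K B] (R : A →ₐ[K] B)
    (N : Fin n → A) (g : MonoidAlgebra K (FreeMonoid (Fin n))) :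
    MonoidAlgebra.lift K B (FreeMonoid (Fin n)) (FreeMonoid.lift fun i => R (N i)) g =
      R (MonoidAlgebra.lift K A (FreeMonoid (Fin n)) (FreeMonoid.lift N) g) := by
  induction g using MonoidAlgebra.induction_on with
  | hM w =>
    simp only [MonoidAlgebra.lift_of]
    induction w using FreeMonoid.inductionOn' with
    | one => simp
    | mul_of b w ih =>
      rw [map_mul, map_mul, ih, FreeMonoid.lift_eval_of, FreeMonoid.lift_eval_of, map_mul]
  | hadd x y hx hy => rw [map_add, map_add, hx, hy, map_add]
  | hsmul r x hx => rw [map_smul, map_smul, hx, map_smul]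

/-- Evaluation commutes with reindexing the matrices. [folklore] -/
theorem lift_reindex {ι : Type} [Fintype ι] [DecidableEq ι] (e : ι ≃ Fin d) (N : Fin n → Matrix ι ι K)
    (g : MonoidAlgebra K (FreeMonoid (Fin n))) :
    MonoidAlgebra.lift K (Matrix (Fin d) (Fin d) K) (FreeMonoid (Fin n))
        (FreeMonoid.lift fun i => Matrix.reindex e e (N i)) g =
      Matrix.reindex e e
        (MonoidAlgebra.lift K (Matrix ι ι K) (FreeMonoid (Fin n)) (FreeMonoid.lift N) g) := by
  exact lift_algHom (Matrix.reindexAlgEquiv K K e : Matrix ι ι K →ₐ[K] Matrix (Fin d) (Fin d) K) N g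

/-- The number of non-zero blocks of a block-diagonal matrix is at most its rank. [folklore] -/
theorem card_filter_ne_zero_le_rank (N : o → Matrix (Fin m) (Fin m) K) [DecidablePred fun k => N k ≠ 0] :
    (Finset.univ.filter fun k => N k ≠ 0).card ≤ (Matrix.blockDiagonal N).rank := by
  classical
  rw [Literature.Barriers.ValiantsHypothesis.rank_blockDiagonal, Finset.card_eq_sum_ones,
    ← Finset.sum_filter_add_sum_filter_not Finset.univ (fun k => N k ≠ 0) (fun k => (N k).rank)]
  refine le_trans (Finset.sum_le_sum fun k hk => ?_) (Nat.le_add_right _ _)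
  have hk' : N k ≠ 0 := (Finset.mem_filter.mp hk).2
  rw [Nat.one_le_iff_ne_zero]
  intro h0
  apply hk'
  have hr : LinearMap.range (N k).mulVecLin = ⊥ := Submodule.finrank_eq_zero.mp h0
  have hlin : (N k).mulVecLin = 0 := LinearMap.range_eq_bot.mp hr
  have : Matrix.toLin' (N k) = Matrix.toLin' 0 := by
    rw [map_zero]; exact hlin
  exact Matrix.toLin'.injective this

/-- **BLOCK LAW.** A block-diagonal almost-representation (blocks of size `m`, axiom ranks `≤ t`) is within
coordinatewise rank `(n² + n) · t · m` of a tuple of pairwise commuting idempotent matrices: zero out the at most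
`(n² + n) · t` blocks on which some Boolean or commutator axiom is non-zero. [folklore] -/
theorem exists_genuine_near_of_blockDiagonal (e : Fin m × o ≃ Fin d) (B : Fin n → o → Matrix (Fin m) (Fin m) K)
    (M : Fin n → Matrix (Fin d) (Fin d) K) (hM : ∀ i, M i = Matrix.reindex e e (Matrix.blockDiagonal (B i)))
    (t : ℕ)
    (hax : ∀ g : MonoidAlgebra K (FreeMonoid (Fin n)), IsAxiom g →
      (MonoidAlgebra.lift K (Matrix (Fin d) (Fin d) K) (FreeMonoid (Fin n)) (FreeMonoid.lift M) g).rank ≤ t) :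
    ∃ M' : Fin n → Matrix (Fin d) (Fin d) K, (∀ i, M' i * M' i = M' i) ∧ (∀ i j, M' i * M' j = M' j * M' i) ∧
      ∀ i, (M i - M' i).rank ≤ (n * n + n) * t * m := by
  classical
  -- evaluation at `M` is the reindexed block-diagonal of the blockwise evaluations
  have hev : ∀ g : MonoidAlgebra K (FreeMonoid (Fin n)),
      MonoidAlgebra.lift K (Matrix (Fin d) (Fin d) K) (FreeMonoid (Fin n)) (FreeMonoid.lift M) g =
        Matrix.reindex e e (Matrix.blockDiagonal fun k =>
          MonoidAlgebra.lift K (Matrix (Fin m) (Fin m) K) (FreeMonoid (Fin n)) (FreeMonoid.lift fun i => B i k) g) := by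
    intro g
    have hM' : M = fun i => Matrix.reindex e e (Matrix.blockDiagonal (B i)) := funext hM
    rw [hM', lift_reindex, lift_blockDiagonal]
  -- the bad blocks
  let bad : Finset o := Finset.univ.filter fun k =>
    (∃ i, B i k * B i k ≠ B i k) ∨ ∃ i j, B i k * B j k ≠ B j k * B i k
  -- Boolean-bad blocks for coordinate `i`
  have hbool : ∀ i : Fin n, (Finset.univ.filter fun k => B i k * B i k - B i k ≠ 0).card ≤ t := by
    intro i
    have h1 := hax (X K i * X K i - X K i) (Or.inl ⟨i, rfl⟩)
    rw [hev, Matrix.rank_reindex] at h1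
    refine le_trans ?_ h1
    have hblk : (fun k => MonoidAlgebra.lift K (Matrix (Fin m) (Fin m) K) (FreeMonoid (Fin n))
        (FreeMonoid.lift fun i => B i k) (X K i * X K i - X K i)) = fun k => B i k * B i k - B i k := by
      funext k; simp [X]
    rw [hblk]
    convert card_filter_ne_zero_le_rank (fun k => B i k * B i k - B i k) using 2
  have hcomm : ∀ i j : Fin n, (Finset.univ.filter fun k => B i k * B j k - B j k * B i k ≠ 0).card ≤ t := by
    intro i j
    by_cases hij : i = j
    · subst hij
      have : (Finset.univ.filter fun k => B i k * B i k - B i k * B i k ≠ 0) = ∅ := by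
        ext k; simp
      rw [this]; simp
    have h1 := hax (X K i * X K j - X K j * X K i) (Or.inr ⟨i, j, hij, rfl⟩)
    rw [hev, Matrix.rank_reindex] at h1
    refine le_trans ?_ h1
    have hblk : (fun k => MonoidAlgebra.lift K (Matrix (Fin m) (Fin m) K) (FreeMonoid (Fin n))
        (FreeMonoid.lift fun i => B i k) (X K i * X K j - X K j * X K i)) =
        fun k => B i k * B j k - B j k * B i k := by
      funext k; simp [X]
    rw [hblk]
    convert card_filter_ne_zero_le_rank (fun k => B i k * B j k - B j k * B i k) using 2
  have hbad_sub : bad ⊆ (Finset.univ.biUnion fun i : Fin n => Finset.univ.filter fun k => B i k * B i k - B i k ≠ 0) ∪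
      (Finset.univ.biUnion fun p : Fin n × Fin n =>
        Finset.univ.filter fun k => B p.1 k * B p.2 k - B p.2 k * B p.1 k ≠ 0) := by
    intro k hk
    rcases (Finset.mem_filter.mp hk).2 with ⟨i, hi⟩ | ⟨i, j, hij⟩
    · refine Finset.mem_union_left _ (Finset.mem_biUnion.mpr ⟨i, Finset.mem_univ _, ?_⟩)
      exact Finset.mem_filter.mpr ⟨Finset.mem_univ _, sub_ne_zero.mpr hi⟩
    · refine Finset.mem_union_right _ (Finset.mem_biUnion.mpr ⟨(i, j), Finset.mem_univ _, ?_⟩)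
      exact Finset.mem_filter.mpr ⟨Finset.mem_univ _, sub_ne_zero.mpr hij⟩
  have hbad_card : bad.card ≤ (n * n + n) * t := by
    refine (Finset.card_le_card hbad_sub).trans ((Finset.card_union_le _ _).trans ?_)
    have hA : (Finset.univ.biUnion fun i : Fin n =>
        Finset.univ.filter fun k => B i k * B i k - B i k ≠ 0).card ≤ n * t := by
      refine Finset.card_biUnion_le.trans ?_
      calc ∑ i : Fin n, (Finset.univ.filter fun k => B i k * B i k - B i k ≠ 0).card
          ≤ ∑ _i : Fin n, t := Finset.sum_le_sum fun i _ => hbool i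
        _ = n * t := by simp
    have hB : (Finset.univ.biUnion fun p : Fin n × Fin n =>
        Finset.univ.filter fun k => B p.1 k * B p.2 k - B p.2 k * B p.1 k ≠ 0).card ≤ n * n * t := by
      refine Finset.card_biUnion_le.trans ?_
      calc ∑ p : Fin n × Fin n, (Finset.univ.filter fun k => B p.1 k * B p.2 k - B p.2 k * B p.1 k ≠ 0).card
          ≤ ∑ _p : Fin n × Fin n, t := Finset.sum_le_sum fun p _ => hcomm p.1 p.2
        _ = n * n * t := by simp [Nat.mul_assoc]
    calc _ ≤ n * t + n * n * t := Nat.add_le_add hA hB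
      _ = (n * n + n) * t := by ring
  -- reindexing is multiplicative / additive
  have h2 : ∀ X Y : Matrix (Fin m × o) (Fin m × o) K,
      Matrix.reindex e e X * Matrix.reindex e e Y = Matrix.reindex e e (X * Y) := fun X Y =>
    (map_mul (Matrix.reindexAlgEquiv K K e) X Y).symm
  have h3 : ∀ X Y : Matrix (Fin m × o) (Fin m × o) K,
      Matrix.reindex e e X - Matrix.reindex e e Y = Matrix.reindex e e (X - Y) := fun X Y =>
    (map_sub (Matrix.reindexAlgEquiv K K e) X Y).symm
  -- the genuine tuple: zero the bad blocks
  refine ⟨fun i => Matrix.reindex e e (Matrix.blockDiagonal fun k => if k ∈ bad then 0 else B i k), ?_, ?_, ?_⟩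
  · intro i
    dsimp only
    rw [h2, ← Matrix.blockDiagonal_mul]
    congr 2; funext k
    by_cases hk : k ∈ bad
    · simp [hk]
    · simp only [hk, if_false]
      by_contra hne
      exact hk (Finset.mem_filter.mpr ⟨Finset.mem_univ _, Or.inl ⟨i, hne⟩⟩)
  · intro i j
    dsimp only
    rw [h2, h2, ← Matrix.blockDiagonal_mul, ← Matrix.blockDiagonal_mul]
    congr 2; funext k
    by_cases hk : k ∈ bad
    · simp [hk]
    · simp only [hk, if_false]
      by_contra hne
      exact hk (Finset.mem_filter.mpr ⟨Finset.mem_univ _, Or.inr ⟨i, j, hne⟩⟩)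
  · intro i
    dsimp only
    rw [hM i]
    have hsub : Matrix.reindex e e (Matrix.blockDiagonal (B i)) -
        Matrix.reindex e e (Matrix.blockDiagonal fun k => if k ∈ bad then 0 else B i k) =
        Matrix.reindex e e (Matrix.blockDiagonal fun k => if k ∈ bad then B i k else 0) := by
      rw [h3, ← Matrix.blockDiagonal_sub]
      congr 2; funext k
      by_cases hk : k ∈ bad <;> simp [hk]
    rw [hsub, Matrix.rank_reindex, Literature.Barriers.ValiantsHypothesis.rank_blockDiagonal]
    calc ∑ k, (if k ∈ bad then B i k else 0).rank
        = ∑ k ∈ bad, (B i k).rank := by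
          rw [← Finset.sum_filter_add_sum_filter_not Finset.univ (fun k => k ∈ bad)]
          have h0 : ∑ k ∈ Finset.univ.filter (fun k => ¬ k ∈ bad), (if k ∈ bad then B i k else 0).rank = 0 :=
            Finset.sum_eq_zero fun k hk => by
              simp [(Finset.mem_filter.mp hk).2]
          rw [h0, add_zero]
          have hf : Finset.univ.filter (fun k => k ∈ bad) = bad := by ext k; simp
          rw [hf]
          exact Finset.sum_congr rfl fun k hk => by simp [hk]
      _ ≤ ∑ _k ∈ bad, m := Finset.sum_le_sum fun k _ => by
          simpa using Matrix.rank_le_card_width (B i k)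
      _ = bad.card * m := by simp
      _ ≤ (n * n + n) * t * m := Nat.mul_le_mul_right m hbad_card

/-- **Block law for the clause product.** At a block-diagonal almost-representation (blocks of size `m`, axiom
ranks `≤ t`), every unsatisfiable CNF `φ` has `rank P_φ(M) ≤ size φ · (n² + n) · t · m`: direct sums of
bounded gadgets never exceed a fixed polynomial ratio, so they cannot witness `RankDefectRepresentations`
(dead construction classes (i)–(v) and the "gadget law" of the crux directory, in one statement). [folklore] -/
theorem rank_clauseProduct_le_of_blockDiagonal (e : Fin m × o ≃ Fin d)
    (B : Fin n → o → Matrix (Fin m) (Fin m) K) (M : Fin n → Matrix (Fin d) (Fin d) K)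
    (hM : ∀ i, M i = Matrix.reindex e e (Matrix.blockDiagonal (B i))) (t : ℕ)
    (hax : ∀ g : MonoidAlgebra K (FreeMonoid (Fin n)), IsAxiom g →
      (MonoidAlgebra.lift K (Matrix (Fin d) (Fin d) K) (FreeMonoid (Fin n)) (FreeMonoid.lift M) g).rank ≤ t)
    {φ : CNF (Fin n)} (hφ : ¬ φ.Satisfiable) :
    (MonoidAlgebra.lift K (Matrix (Fin d) (Fin d) K) (FreeMonoid (Fin n)) (FreeMonoid.lift M)
      (clauseProduct K φ)).rank ≤ φ.size * ((n * n + n) * t * m) := by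
  obtain ⟨M', hidem, hcomm, hdist⟩ := exists_genuine_near_of_blockDiagonal e B M hM t hax
  exact rank_eval_clauseProduct_le_size_mul M M' hidem hcomm hφ hdist

/-- **Block law for phantoms (gadget law of the line `phantom-kernel`).** At a block-diagonal
almost-representation (blocks of size `m`, axiom ranks `≤ t`), the phantom kernel `⋂_{κ∈φ} ker Q_κ(M)` of every
unsatisfiable CNF `φ` has dimension `≤ size φ · (n² + n) · t · m` (peeling `finrank_iInf_ker_le_rank_clauseProduct`
+ the block law): direct sums of bounded gadgets give at most a fixed polynomial ratio `dim U / t`, so the stub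
`stub_contradictoryPhantoms` (S1) needs indecomposable blocks of superpolynomial dimension. [folklore] -/
theorem finrank_phantom_le_of_blockDiagonal (e : Fin m × o ≃ Fin d)
    (B : Fin n → o → Matrix (Fin m) (Fin m) K) (M : Fin n → Matrix (Fin d) (Fin d) K)
    (hM : ∀ i, M i = Matrix.reindex e e (Matrix.blockDiagonal (B i))) (t : ℕ)
    (hax : ∀ g : MonoidAlgebra K (FreeMonoid (Fin n)), IsAxiom g →
      (MonoidAlgebra.lift K (Matrix (Fin d) (Fin d) K) (FreeMonoid (Fin n)) (FreeMonoid.lift M) g).rank ≤ t)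
    {φ : CNF (Fin n)} (hφ : ¬ φ.Satisfiable) :
    Module.finrank K (⨅ κ ∈ φ, LinearMap.ker (Matrix.toLin'
      (MonoidAlgebra.lift K (Matrix (Fin d) (Fin d) K) (FreeMonoid (Fin n)) (FreeMonoid.lift M)
        (clauseWord K κ))) : Submodule K (Fin d → K)) ≤ φ.size * ((n * n + n) * t * m) :=
  (finrank_iInf_ker_le_rank_clauseProduct M φ).trans (rank_clauseProduct_le_of_blockDiagonal e B M hM t hax hφ)

end BlockLaw

end Summit.PneNP.PneNP.Theorems.CnfIdealGenLength
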